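import Summits.BirchSwinnertonDyer.BirchSwinnertonDyer.Theorems.EisensteinPrimesMazurMCOnCellBKernelCertP13NoUnitVertex
import Summits.BirchSwinnertonDyer.BirchSwinnertonDyer.Theorems.EisensteinPrimesMazurMCOnCellBKernelCertP13PredictedCell
import Summits.BirchSwinnertonDyer.BirchSwinnertonDyer.Theorems.EisensteinPrimesMazurMCOnCellBKernelCertP13ThirdCell
import Summits.BirchSwinnertonDyer.BirchSwinnertonDyer.Theorems.EisensteinPrimesMazurMCOnCellBKernelCertP13FourthCell
import Summits.BirchSwinnertonDyer.BirchSwinnertonDyer.Theorems.EisensteinPrimesMazurMCOnCellBKernelCertP13FifthCell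
import Summits.BirchSwinnertonDyer.BirchSwinnertonDyer.Theorems.EisensteinPrimesMazurMCOnCellBKernelCertP13SplitA10Cell
import Summits.BirchSwinnertonDyer.BirchSwinnertonDyer.Theorems.EisensteinPrimesMazurMCOnCellBKernelCertP13InertCell
import Summits.BirchSwinnertonDyer.BirchSwinnertonDyer.Theorems.EisensteinPrimesMazurMCOnCellBKernelCertP13DoorPrice
import Literature.NumberTheory.EllipticCurves.PAdicLFunctionQuadraticTwistBirchSharedPrimesProofs
import Literature.NumberTheory.EllipticCurves.RootNumberSmulProofs
import Literature.NumberTheory.EllipticCurves.IsogenyConductorModularityProofs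
import Literature.NumberTheory.QuadraticFields.HeegnerCondition
import HarnessLib

/-!
# Crux 3 `MazurMCOnCellB` (stmt-BirchSwinnertonDyer-19033) — the `p = 13` slice: DOOR PRICE AT THE WHOLE ISOGENY CLASS, part I — for EVERY curve `W₁` isogenous to the
# displayed `E` of an A10-type cell at `13` (granted modularity, which the doors' cone `EisensteinPrimes.PublishedInputs` contains): (i) any field Heegner for `N_{W₁}` has
# `d ≤ −B` (forward two-step edges and the order-one anchor from ANY vertex of the class), and (ii) — NEW — every REVERSE edge `TwoStepAt 13 U W₁` INTO the class has second
# field `K″` with `d_{K″} ≤ −B′` and carries an analytic-rank-ONE certificate for a curve `Wd` with `W₁ ≅ Wd ⊗ χ_{d_{K″}}`: the FIRST STEP of every zig-zag of twistback 6⁷'s left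
# door out of the class is priced in the kernel (`B′ ≤ B` is the residue-level bound: primes of `N_E` may ramify in `K″` — «untwisting»)

Width seat bsd-line-x2-p1-w6 (gen 21), cell `bsd-eis` (run/shared/lean/pub/bsd-eis/), 2026-08-30; `--supports stmt-BirchSwinnertonDyer-19033 --as helper`.
THEOREMS ONLY (no `def`, no named fact, no `sorry`, no instance). Registered line `twistback` v13b is NOT touched; nothing here closes a stub.

WHY. The left door `…_of_connectedClassShaUnit` of the cell files takes `h0 : ∃ W₁ ∼ W, Relation.ReflTransGen (fun A B ↦ TwoStepAt 13 A B ∨ (TwoStepAt 13 B A ∧ CellB B)) W₁ U ∧ …`: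
the zig-zag may start at ANY model `W₁` of ANY curve isogenous to `E`, and its first step may be an edge OUT of `W₁` (priced by `…DoorPrice`/`…DoorPriceII` at `W₁ = E, E′`
only) or an edge INTO `W₁` (not priced so far; memo §1.5 numerics). This file prices both at the class level.
HOW. §0: `dvd_conductorNorm_of_smul_eq_quadraticTwist` — if `C • W = Wd ⊗ χ_d` (`d ≡ 1 (mod 4)`) and `q ∣ N_W`, `q ∤ d`, then `q ∣ N_{Wd}` (the conductor exponent at `q ∤ d` is
twist-invariant: `factorization_conductorNorm_quadraticTwist_eq_of_not_dvd`; isomorphism-invariant: `conductorExponent_smul'`); the engine `discr_le_of_twoStepAt_into_of_check`: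
unfolding `TwoStepAt 13 U W` (`K`, `Wd ≅ U^{(d_K)}` with `r_an = 1`, `K″` Heegner for `N_{Wd}` and `13`, `C • W = Wd ⊗ χ_{d_{K″}}`), every prime `q ∣ N_W` either divides `d_{K″}`
or divides `N_{Wd}` hence SPLITS in `K″` (`d ≡ 1 (mod 8)` at `2` — `d` odd —, Euler's criterion at odd `q`; `13` splits by `K″`'s own hypothesis); a finite residue check over
`D ∈ (−B′, −4)` (`decide +kernel`) closes `d_{K″} ≤ −B′`; `Wd.analyticRank = 1` from `r_an(U^{(d_K)}) = 1` by `analyticRank_smul`. §k per cell: `bad_dvd_conductorNorm_<tag>`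
(the bad primes divide `N_E`, kernel), transported to any `W₁ ∼ E` by `ModularForms.conductorNorm_eq_of_isIsogenous_of_modularity hmod` (Atkin–Lehner: isogenous curves have
equal conductor, granted modularity); then `discr_le_of_heegner_isogenous_<tag>` (forward/anchor, from the landed `discr_le_of_heegner_<tag>`) and
`twoStepAt_into_isogenous_<tag>` (reverse). CELLS: g19 (−19/13 ⊗ χ₋₄₂ (w6 g19, p745174)): N = 504452265408, B = 335, B′ = 231; A (−46/13 ⊗ χ₋₂₇₅₅ (w6 g20, p754117)): N = 222402912550, B = 2159, B′ = 1095; B (−57/13 ⊗ χ₋₁₇₄₁ (w6 g20, p756161)): N = 14374598534400, B = 599, B′ = 399; C (−46/13 ⊗ χ₋₂₂₈₉ (w6 g20, p756413)): N = 21080395378224, B = 2159, B′ = 1095; D (−46/13 ⊗ χ₋₂₅₃₄ (w6 g20, p757375)): N = 25834519465664, B = 1095, B′ = 1095; S (−46/13 ⊗ χ₋₁₇₁₁, 13 SPLIT (w6 g20, p757194)): N = 85782220342, B = 103, B′ = 103; I (−32/13 ⊗ χ₋₁₄₇₉ (w6 g20, p759720)): N = 74042484789546, B = 1223, B′ = 399.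 NUMERICS (memo §1.5, not kernel): with Tate's algorithm on the twists the true least reverse fields are
−335 (g19), −1095 (A; conductor of `E^{(−1095)}` = 4.27·10¹⁴), −599 (B), −1095 (C; 3.1·10¹⁷), −1223 (I), −1167 (#9; 3.0·10¹⁸), −615 (#13; 1.3·10¹⁶), else `= −B`; the
kernel `B′` here is the weaker residue-level bound (it cannot see whether an untwisted prime really leaves the conductor).
HONEST FRAMING: elementary kernel facts about explicit equations, conductors of twists and quadratic residues, CONDITIONAL on `nonempty_modularParametrizationData` (modularity,
a conjunct of the doors' own cone) for the class transport only; nothing about any L-value, Selmer group, main conjecture or BSD is asserted; the doors stay CONDITIONAL and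
un-instantiated; closes no registered stub; 0 cells / labels / stubs / tiers move; no summit statement, no case of Mazur's main conjecture and no case of BSD is proved for any
curve. Memo of record: `P13-DESCENT-ATLAS-w6g21.md` §1 (evidence on -19033); mirror `HOME/line-x2-p1-w6-g21/`.
References: [GrossLMS1991] §1; [AtkinLehner1970] Thm. 4; [SilvermanATAEC1994] IV.9.4, IV.10, Exercise 4.40; [SilvermanAEC2009] App. C §16; [IrelandRosen1990] Prop. 13.1.3–13.1.4;
this lane's `…KernelCertP13DoorPrice` (p764408), `…DoorPriceII`, `…DoorPriceSharp`, x2-p1-w6 g3 `…TwistbackTwoStepDefs`.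
-/

set_option autoImplicit false
-- `Summit.BirchSwinnertonDyer.BirchSwinnertonDyer.…`: the summit and its single sub-problem share a name.
set_option linter.dupNamespace false

noncomputable section

open scoped Classical
open WeierstrassCurve NumberField Literature.NumberTheory.EllipticCurves
  Literature.NumberTheory.EllipticCurves.ModularForms
  Literature.NumberTheory.QuadraticFields
  Summit.BirchSwinnertonDyer.BirchSwinnertonDyer.Rank1Residual.X11RankOne
  Summit.BirchSwinnertonDyer.BirchSwinnertonDyer.Theorems
  Summit.BirchSwinnertonDyer.BirchSwinnertonDyer.Theorems.EisensteinPrimesMazurMCOnCellBTwistbackTwoStepDefs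
  Summit.BirchSwinnertonDyer.BirchSwinnertonDyer.Theorems.EisensteinPrimesMazurMCOnCellBKernelCertP13DoorPrice

namespace Summit.BirchSwinnertonDyer.BirchSwinnertonDyer.Theorems.EisensteinPrimesMazurMCOnCellBKernelCertP13DoorPriceClassI

/-! ## §0 Generic: conductor primes of a model of a twist; the reverse-edge engine -/

/-- **A prime `q ∤ d` of the conductor of a model `W` of `Wd ⊗ χ_d` divides the conductor of `Wd`** (`d ≡ 1 (mod 4)`): the conductor exponent at a place prime to `d` is
invariant under the twist (`factorization_conductorNorm_quadraticTwist_eq_of_not_dvd`) and under isomorphism (`conductorExponent_smul'`).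
[cite: SilvermanATAEC1994, IV.9.4 and IV.10] [cite: SilvermanAEC2009, App. C §16] -/
theorem dvd_conductorNorm_of_smul_eq_quadraticTwist {W Wd : WeierstrassCurve ℚ} [W.IsElliptic] [Wd.IsElliptic]
    {d : ℤ} (hd4 : d % 4 = 1) {C : VariableChange ℚ} (hC : C • W = Wd.quadraticTwist (d : ℚ))
    {q : ℕ} (hq : q.Prime) (hqW : q ∣ W.conductorNorm ℤ) (hqd : ¬ (q : ℤ) ∣ d) : q ∣ Wd.conductorNorm ℤ := by
  have hd0 : d ≠ 0 := by omega
  have hdq : (d : ℚ) ≠ 0 := by exact_mod_cast hd0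
  haveI := Wd.isElliptic_quadraticTwist hdq
  set v : IsDedekindDomain.HeightOneSpectrum ℤ := (Rat.HeightOneSpectrum.primesEquiv (R := ℤ)).symm ⟨q, hq⟩ with hv
  have hgen : Rat.HeightOneSpectrum.natGenerator v = q :=
    congrArg Subtype.val ((Rat.HeightOneSpectrum.primesEquiv (R := ℤ)).apply_symm_apply ⟨q, hq⟩)
  have hfW := factorization_conductorNorm_holds W v
  have hfT := factorization_conductorNorm_holds (Wd.quadraticTwist (d : ℚ)) v
  have htw := Wd.factorization_conductorNorm_quadraticTwist_eq_of_not_dvd hd4 v (by rw [hgen]; exact hqd)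
  rw [hgen] at hfW hfT htw
  have hsm : (C • W).conductorExponent v = W.conductorExponent v := conductorExponent_smul' v W C
  rw [hC] at hsm
  have hpos : 0 < (W.conductorNorm ℤ).factorization q :=
    hq.factorization_pos_of_dvd (conductorNorm_pos_holds W).ne' hqW
  rw [hfW, ← hsm, ← hfT, htw] at hpos
  exact Nat.dvd_of_factorization_pos (Nat.pos_iff_ne_zero.mp hpos)

/-- **Reverse-edge engine.** For an elliptic `W` whose conductor is divisible by `2` and by every prime of a list `ps` of odd primes: if NO `D ∈ (B′, −4)` with `D ≡ 1 (mod 8)`,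
`(D/13) = 1`, and `q ∣ D ∨ (D/q) = 1` for all `q ∈ ps` exists (finite check), then every reverse edge `TwoStepAt 13 U W` has second field `K` with `d_K ≤ B′` and a curve `Wd`
(globally minimal model of `U^{(d_{K₁})}`) with `C • W = Wd ⊗ χ_{d_K}` and `Wd.analyticRank = 1` (`analyticRank_smul`). [cite: GrossLMS1991, §1 (p. 235)] -/
theorem discr_le_of_twoStepAt_into_of_check {W : WeierstrassCurve ℚ} [W.IsElliptic] (ps : List ℕ)
    (h2 : 2 ∣ W.conductorNorm ℤ) (hps : ∀ q ∈ ps, q.Prime ∧ q ≠ 2 ∧ q ∣ W.conductorNorm ℤ) (B : ℤ)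
    (hcheck : ∀ D ∈ Finset.Ioo B (-4), D % 8 = 1 → (D : ZMod 13) ^ 6 = 1 →
      (∀ q ∈ ps, (q : ℤ) ∣ D ∨ (D : ZMod q) ^ (q / 2) = 1) → False)
    (U : WeierstrassCurve ℚ) (h : TwoStepAt 13 U W) :
    ∃ (K : Type) (_ : Field K) (_ : NumberField K), IsImaginaryQuadratic K ∧ NumberField.discr K ≤ B ∧
      ∃ (Wd : WeierstrassCurve ℚ) (_ : Wd.IsElliptic) (_ : Wd.IsGloballyMinimal),
        (∃ C : VariableChange ℚ, C • W = Wd.quadraticTwist (NumberField.discr K : ℚ)) ∧ Wd.analyticRank = 1 := by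
  obtain ⟨_, _, _, _, K₁, _, _, hK₁, -, -, -, -, hr1, Wd, hWdE, hWdM, ⟨C₁, hC₁⟩, K, iF, iN, hK, hodd, hlt, hHN, hHp, -,
    ⟨C, hC⟩⟩ := h
  have hd4 : NumberField.discr K % 4 = 1 := by
    rcases Quadratic.discr_emod_four hK.1 with h0 | h1
    · exfalso; rw [Int.odd_iff] at hodd; omega
    · exact h1
  have h8 : NumberField.discr K % 8 = 1 := by
    have h2d : ¬ (2 : ℤ) ∣ NumberField.discr K := by rw [Int.odd_iff] at hodd; omega
    exact discr_emod_eight_of_heegner hK hHN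
      (dvd_conductorNorm_of_smul_eq_quadraticTwist hd4 hC Nat.prime_two h2 (by exact_mod_cast h2d))
  haveI : Fact (Nat.Prime 13) := ⟨by norm_num⟩
  have h13 : ((NumberField.discr K : ℤ) : ZMod 13) ^ (13 / 2) = 1 :=
    discr_pow_eq_one_of_heegner hK hHp 13 (by decide) (dvd_refl 13)
  have hres : ∀ q ∈ ps, (q : ℤ) ∣ NumberField.discr K ∨ ((NumberField.discr K : ℤ) : ZMod q) ^ (q / 2) = 1 := by
    intro q hq
    obtain ⟨hqp, hq2, hqN⟩ := hps q hq
    by_cases hqd : (q : ℤ) ∣ NumberField.discr K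
    · exact Or.inl hqd
    · haveI : Fact q.Prime := ⟨hqp⟩
      exact Or.inr (discr_pow_eq_one_of_heegner hK hHN q hq2
        (dvd_conductorNorm_of_smul_eq_quadraticTwist hd4 hC hqp hqN hqd))
  have hle : NumberField.discr K ≤ B := by
    by_contra hgt
    exact hcheck (NumberField.discr K) (Finset.mem_Ioo.mpr ⟨by omega, hlt⟩) h8 h13 hres
  refine ⟨K, iF, iN, hK, hle, Wd, hWdE, hWdM, ⟨C, hC⟩, ?_⟩
  rw [← WeierstrassCurve.analyticRank_smul Wd C₁, hC₁]
  exact hr1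


/-! ## Cell g19 — −19/13 ⊗ χ₋₄₂ (w6 g19, p745174), `N = 504452265408`, bad primes `{2} ∪ [3, 7, 13, 19, 269]`: forward/anchor `B = 335`, reverse `B′ = 231` -/

/-- The bad primes `{2} ∪ [3, 7, 13, 19, 269]` all divide `N_E` (kernel: `…DoorPrice.dvd_conductorNorm_of_dvd_Δ` from the integer equation). [cite: BombieriGubler2006, 12.5.9(d)] -/
theorem bad_dvd_conductorNorm_e13a10 : ∀ q ∈ ((2 :: [3, 7, 13, 19, 269]) : List ℕ), q ∣ (⟨0, 0, 0, 55547317476, 58239761976082638⟩ : WeierstrassCurve ℚ).conductorNorm ℤ := by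
  haveI := EisensteinPrimesMazurMCOnCellBKernelCertP13NoUnitVertex.isElliptic_e13a10; haveI := EisensteinPrimesMazurMCOnCellBKernelCertP13NoUnitVertex.isGloballyMinimal_e13a10
  have hb := baseChange_mk_int 0 0 0 55547317476 58239761976082638
  push_cast at hb
  intro q hq; fin_cases hq <;> exact dvd_conductorNorm_of_dvd_Δ _ hb (by norm_num) (by rw [intCurve_Δ]; decide +kernel)

/-- **Forward edges and anchors from ANY curve `W₁` isogenous to `E` (cell g19): a field Heegner for `N_{W₁}` with `d < −4` has `d ≤ −335`** — `N_{W₁} = N_E` granted modularity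
(`ModularForms.conductorNorm_eq_of_isIsogenous_of_modularity`, Atkin–Lehner) and the landed `discr_le_of_heegner_e13a10`. [cite: AtkinLehner1970, Thm. 4] [cite: GrossLMS1991, §1 (p. 235)] -/
theorem discr_le_of_heegner_isogenous_e13a10 (hmod : nonempty_modularParametrizationData) (W₁ : WeierstrassCurve ℚ) [W₁.IsElliptic]
    (hiso : IsIsogenous (⟨0, 0, 0, 55547317476, 58239761976082638⟩ : WeierstrassCurve ℚ) W₁) (K₀ : Type) [Field K₀] [NumberField K₀] (hK : IsImaginaryQuadratic K₀)
    (hHN : SatisfiesHeegnerHypothesis (W₁.conductorNorm ℤ) K₀) (hlt : NumberField.discr K₀ < -4) : NumberField.discr K₀ ≤ -335 := by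
  haveI := EisensteinPrimesMazurMCOnCellBKernelCertP13NoUnitVertex.isElliptic_e13a10
  rw [← conductorNorm_eq_of_isIsogenous_of_modularity hmod _ W₁ hiso] at hHN
  exact EisensteinPrimesMazurMCOnCellBKernelCertP13DoorPrice.discr_le_of_heegner_e13a10 K₀ hK hHN hlt

/-- Finite residue check for reverse edges at cell g19: no `D ∈ (−231, −4)` with `D ≡ 1 (8)`, `(D/13) = 1` and `q ∣ D ∨ (D/q) = 1` for `q ∈ [3, 7, 13, 19, 269]`. [folklore] -/
theorem no_reverse_discr_e13a10 : ∀ D ∈ Finset.Ioo (-231 : ℤ) (-4), D % 8 = 1 → (D : ZMod 13) ^ 6 = 1 →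
    (∀ q ∈ ([3, 7, 13, 19, 269] : List ℕ), (q : ℤ) ∣ D ∨ (D : ZMod q) ^ (q / 2) = 1) → False := by
  decide +kernel

/-- **REVERSE edges into ANY curve `W₁` isogenous to `E` (cell g19): every `TwoStepAt 13 U W₁` has second field `K″` with `d_{K″} ≤ −231` and carries an analytic-rank-ONE
certificate for a curve `Wd` with `W₁ ≅ Wd ⊗ χ_{d_{K″}}`** (granted modularity for `N_{W₁} = N_E`). The first step of every zig-zag of 6⁷'s left door out of the class of `E` is thus an
`L`-reading: forward `r_an(W₁^{(d)}) = 1`, `|d| ≥ 335`, or reverse `r_an(Wd) = 1`, `Wd ≅ W₁ ⊗ χ_d`, `|d| ≥ 231`. [cite: GrossLMS1991, §1 (p. 235)] [cite: AtkinLehner1970, Thm. 4] -/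
theorem twoStepAt_into_isogenous_e13a10 (hmod : nonempty_modularParametrizationData) (W₁ : WeierstrassCurve ℚ) [W₁.IsElliptic]
    (hiso : IsIsogenous (⟨0, 0, 0, 55547317476, 58239761976082638⟩ : WeierstrassCurve ℚ) W₁) (U : WeierstrassCurve ℚ) (h : TwoStepAt 13 U W₁) :
    ∃ (K : Type) (_ : Field K) (_ : NumberField K), IsImaginaryQuadratic K ∧ NumberField.discr K ≤ -231 ∧
      ∃ (Wd : WeierstrassCurve ℚ) (_ : Wd.IsElliptic) (_ : Wd.IsGloballyMinimal),
        (∃ C : VariableChange ℚ, C • W₁ = Wd.quadraticTwist (NumberField.discr K : ℚ)) ∧ Wd.analyticRank = 1 := by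
  haveI := EisensteinPrimesMazurMCOnCellBKernelCertP13NoUnitVertex.isElliptic_e13a10
  have hN := conductorNorm_eq_of_isIsogenous_of_modularity hmod _ W₁ hiso
  have hb := bad_dvd_conductorNorm_e13a10
  exact discr_le_of_twoStepAt_into_of_check [3, 7, 13, 19, 269] (hN ▸ hb 2 (by simp)) (by intro q hq; fin_cases hq <;> exact ⟨by norm_num, by decide, hN ▸ hb _ (by simp)⟩)
    (-231) no_reverse_discr_e13a10 U h

/-! ## Cell A — −46/13 ⊗ χ₋₂₇₅₅ (w6 g20, p754117), `N = 222402912550`, bad primes `{2} ∪ [5, 7, 13, 19, 23, 29]`: forward/anchor `B = 2159`, reverse `B′ = 1095` -/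

/-- The bad primes `{2} ∪ [5, 7, 13, 19, 23, 29]` all divide `N_E` (kernel: `…DoorPrice.dvd_conductorNorm_of_dvd_Δ` from the integer equation). [cite: BombieriGubler2006, 12.5.9(d)] -/
theorem bad_dvd_conductorNorm_e13a11 : ∀ q ∈ ((2 :: [5, 7, 13, 19, 23, 29]) : List ℕ), q ∣ (⟨1, -1, 0, -593429616434692, 5637904708055929338966⟩ : WeierstrassCurve ℚ).conductorNorm ℤ := by
  haveI := EisensteinPrimesMazurMCOnCellBKernelCertP13PredictedCell.isElliptic_e13a11; haveI := EisensteinPrimesMazurMCOnCellBKernelCertP13PredictedCell.isGloballyMinimal_e13a11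
  have hb := baseChange_mk_int 1 (-1) 0 (-593429616434692) 5637904708055929338966
  push_cast at hb
  intro q hq; fin_cases hq <;> exact dvd_conductorNorm_of_dvd_Δ _ hb (by norm_num) (by rw [intCurve_Δ]; decide +kernel)

/-- **Forward edges and anchors from ANY curve `W₁` isogenous to `E` (cell A): a field Heegner for `N_{W₁}` with `d < −4` has `d ≤ −2159`** — `N_{W₁} = N_E` granted modularity
(`ModularForms.conductorNorm_eq_of_isIsogenous_of_modularity`, Atkin–Lehner) and the landed `discr_le_of_heegner_e13a11`. [cite: AtkinLehner1970, Thm. 4] [cite: GrossLMS1991, §1 (p. 235)] -/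
theorem discr_le_of_heegner_isogenous_e13a11 (hmod : nonempty_modularParametrizationData) (W₁ : WeierstrassCurve ℚ) [W₁.IsElliptic]
    (hiso : IsIsogenous (⟨1, -1, 0, -593429616434692, 5637904708055929338966⟩ : WeierstrassCurve ℚ) W₁) (K₀ : Type) [Field K₀] [NumberField K₀] (hK : IsImaginaryQuadratic K₀)
    (hHN : SatisfiesHeegnerHypothesis (W₁.conductorNorm ℤ) K₀) (hlt : NumberField.discr K₀ < -4) : NumberField.discr K₀ ≤ -2159 := by
  haveI := EisensteinPrimesMazurMCOnCellBKernelCertP13PredictedCell.isElliptic_e13a11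
  rw [← conductorNorm_eq_of_isIsogenous_of_modularity hmod _ W₁ hiso] at hHN
  exact EisensteinPrimesMazurMCOnCellBKernelCertP13DoorPrice.discr_le_of_heegner_e13a11 K₀ hK hHN hlt

/-- Finite residue check for reverse edges at cell A: no `D ∈ (−1095, −4)` with `D ≡ 1 (8)`, `(D/13) = 1` and `q ∣ D ∨ (D/q) = 1` for `q ∈ [5, 7, 13, 19, 23, 29]`. [folklore] -/
theorem no_reverse_discr_e13a11 : ∀ D ∈ Finset.Ioo (-1095 : ℤ) (-4), D % 8 = 1 → (D : ZMod 13) ^ 6 = 1 →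
    (∀ q ∈ ([5, 7, 13, 19, 23, 29] : List ℕ), (q : ℤ) ∣ D ∨ (D : ZMod q) ^ (q / 2) = 1) → False := by
  decide +kernel

/-- **REVERSE edges into ANY curve `W₁` isogenous to `E` (cell A): every `TwoStepAt 13 U W₁` has second field `K″` with `d_{K″} ≤ −1095` and carries an analytic-rank-ONE
certificate for a curve `Wd` with `W₁ ≅ Wd ⊗ χ_{d_{K″}}`** (granted modularity for `N_{W₁} = N_E`). The first step of every zig-zag of 6⁷'s left door out of the class of `E` is thus an
`L`-reading: forward `r_an(W₁^{(d)}) = 1`, `|d| ≥ 2159`, or reverse `r_an(Wd) = 1`, `Wd ≅ W₁ ⊗ χ_d`, `|d| ≥ 1095`. [cite: GrossLMS1991, §1 (p. 235)] [cite: AtkinLehner1970, Thm. 4] -/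
theorem twoStepAt_into_isogenous_e13a11 (hmod : nonempty_modularParametrizationData) (W₁ : WeierstrassCurve ℚ) [W₁.IsElliptic]
    (hiso : IsIsogenous (⟨1, -1, 0, -593429616434692, 5637904708055929338966⟩ : WeierstrassCurve ℚ) W₁) (U : WeierstrassCurve ℚ) (h : TwoStepAt 13 U W₁) :
    ∃ (K : Type) (_ : Field K) (_ : NumberField K), IsImaginaryQuadratic K ∧ NumberField.discr K ≤ -1095 ∧
      ∃ (Wd : WeierstrassCurve ℚ) (_ : Wd.IsElliptic) (_ : Wd.IsGloballyMinimal),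
        (∃ C : VariableChange ℚ, C • W₁ = Wd.quadraticTwist (NumberField.discr K : ℚ)) ∧ Wd.analyticRank = 1 := by
  haveI := EisensteinPrimesMazurMCOnCellBKernelCertP13PredictedCell.isElliptic_e13a11
  have hN := conductorNorm_eq_of_isIsogenous_of_modularity hmod _ W₁ hiso
  have hb := bad_dvd_conductorNorm_e13a11
  exact discr_le_of_twoStepAt_into_of_check [5, 7, 13, 19, 23, 29] (hN ▸ hb 2 (by simp)) (by intro q hq; fin_cases hq <;> exact ⟨by norm_num, by decide, hN ▸ hb _ (by simp)⟩)
    (-1095) no_reverse_discr_e13a11 U h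

/-! ## Cell B — −57/13 ⊗ χ₋₁₇₄₁ (w6 g20, p756161), `N = 14374598534400`, bad primes `{2} ∪ [3, 5, 13, 19, 1741]`: forward/anchor `B = 599`, reverse `B′ = 399` -/

/-- The bad primes `{2} ∪ [3, 5, 13, 19, 1741]` all divide `N_E` (kernel: `…DoorPrice.dvd_conductorNorm_of_dvd_Δ` from the integer equation). [cite: BombieriGubler2006, 12.5.9(d)] -/
theorem bad_dvd_conductorNorm_e13a12 : ∀ q ∈ ((2 :: [3, 5, 13, 19, 1741]) : List ℕ), q ∣ (⟨0, 1, 0, -10265161435863023, 400579876938524794946733⟩ : WeierstrassCurve ℚ).conductorNorm ℤ := by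
  haveI := EisensteinPrimesMazurMCOnCellBKernelCertP13ThirdCell.isElliptic_e13a12; haveI := EisensteinPrimesMazurMCOnCellBKernelCertP13ThirdCell.isGloballyMinimal_e13a12
  have hb := baseChange_mk_int 0 1 0 (-10265161435863023) 400579876938524794946733
  push_cast at hb
  intro q hq; fin_cases hq <;> exact dvd_conductorNorm_of_dvd_Δ _ hb (by norm_num) (by rw [intCurve_Δ]; decide +kernel)

/-- **Forward edges and anchors from ANY curve `W₁` isogenous to `E` (cell B): a field Heegner for `N_{W₁}` with `d < −4` has `d ≤ −599`** — `N_{W₁} = N_E` granted modularity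
(`ModularForms.conductorNorm_eq_of_isIsogenous_of_modularity`, Atkin–Lehner) and the landed `discr_le_of_heegner_e13a12`. [cite: AtkinLehner1970, Thm. 4] [cite: GrossLMS1991, §1 (p. 235)] -/
theorem discr_le_of_heegner_isogenous_e13a12 (hmod : nonempty_modularParametrizationData) (W₁ : WeierstrassCurve ℚ) [W₁.IsElliptic]
    (hiso : IsIsogenous (⟨0, 1, 0, -10265161435863023, 400579876938524794946733⟩ : WeierstrassCurve ℚ) W₁) (K₀ : Type) [Field K₀] [NumberField K₀] (hK : IsImaginaryQuadratic K₀)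
    (hHN : SatisfiesHeegnerHypothesis (W₁.conductorNorm ℤ) K₀) (hlt : NumberField.discr K₀ < -4) : NumberField.discr K₀ ≤ -599 := by
  haveI := EisensteinPrimesMazurMCOnCellBKernelCertP13ThirdCell.isElliptic_e13a12
  rw [← conductorNorm_eq_of_isIsogenous_of_modularity hmod _ W₁ hiso] at hHN
  exact EisensteinPrimesMazurMCOnCellBKernelCertP13DoorPrice.discr_le_of_heegner_e13a12 K₀ hK hHN hlt

/-- Finite residue check for reverse edges at cell B: no `D ∈ (−399, −4)` with `D ≡ 1 (8)`, `(D/13) = 1` and `q ∣ D ∨ (D/q) = 1` for `q ∈ [3, 5, 13, 19, 1741]`. [folklore] -/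
theorem no_reverse_discr_e13a12 : ∀ D ∈ Finset.Ioo (-399 : ℤ) (-4), D % 8 = 1 → (D : ZMod 13) ^ 6 = 1 →
    (∀ q ∈ ([3, 5, 13, 19, 1741] : List ℕ), (q : ℤ) ∣ D ∨ (D : ZMod q) ^ (q / 2) = 1) → False := by
  decide +kernel

/-- **REVERSE edges into ANY curve `W₁` isogenous to `E` (cell B): every `TwoStepAt 13 U W₁` has second field `K″` with `d_{K″} ≤ −399` and carries an analytic-rank-ONE
certificate for a curve `Wd` with `W₁ ≅ Wd ⊗ χ_{d_{K″}}`** (granted modularity for `N_{W₁} = N_E`). The first step of every zig-zag of 6⁷'s left door out of the class of `E` is thus an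
`L`-reading: forward `r_an(W₁^{(d)}) = 1`, `|d| ≥ 599`, or reverse `r_an(Wd) = 1`, `Wd ≅ W₁ ⊗ χ_d`, `|d| ≥ 399`. [cite: GrossLMS1991, §1 (p. 235)] [cite: AtkinLehner1970, Thm. 4] -/
theorem twoStepAt_into_isogenous_e13a12 (hmod : nonempty_modularParametrizationData) (W₁ : WeierstrassCurve ℚ) [W₁.IsElliptic]
    (hiso : IsIsogenous (⟨0, 1, 0, -10265161435863023, 400579876938524794946733⟩ : WeierstrassCurve ℚ) W₁) (U : WeierstrassCurve ℚ) (h : TwoStepAt 13 U W₁) :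
    ∃ (K : Type) (_ : Field K) (_ : NumberField K), IsImaginaryQuadratic K ∧ NumberField.discr K ≤ -399 ∧
      ∃ (Wd : WeierstrassCurve ℚ) (_ : Wd.IsElliptic) (_ : Wd.IsGloballyMinimal),
        (∃ C : VariableChange ℚ, C • W₁ = Wd.quadraticTwist (NumberField.discr K : ℚ)) ∧ Wd.analyticRank = 1 := by
  haveI := EisensteinPrimesMazurMCOnCellBKernelCertP13ThirdCell.isElliptic_e13a12
  have hN := conductorNorm_eq_of_isIsogenous_of_modularity hmod _ W₁ hiso
  have hb := bad_dvd_conductorNorm_e13a12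
  exact discr_le_of_twoStepAt_into_of_check [3, 5, 13, 19, 1741] (hN ▸ hb 2 (by simp)) (by intro q hq; fin_cases hq <;> exact ⟨by norm_num, by decide, hN ▸ hb _ (by simp)⟩)
    (-399) no_reverse_discr_e13a12 U h

/-! ## Cell C — −46/13 ⊗ χ₋₂₂₈₉ (w6 g20, p756413), `N = 21080395378224`, bad primes `{2} ∪ [3, 7, 13, 23, 29, 109]`: forward/anchor `B = 2159`, reverse `B′ = 1095` -/

/-- The bad primes `{2} ∪ [3, 7, 13, 23, 29, 109]` all divide `N_E` (kernel: `…DoorPrice.dvd_conductorNorm_of_dvd_Δ` from the integer equation). [cite: BombieriGubler2006, 12.5.9(d)] -/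
theorem bad_dvd_conductorNorm_e13a13 : ∀ q ∈ ((2 :: [3, 7, 13, 23, 29, 109]) : List ℕ), q ∣ (⟨0, 0, 0, -6554469978333963, 206952302283565583167290⟩ : WeierstrassCurve ℚ).conductorNorm ℤ := by
  haveI := EisensteinPrimesMazurMCOnCellBKernelCertP13FourthCell.isElliptic_e13a13; haveI := EisensteinPrimesMazurMCOnCellBKernelCertP13FourthCell.isGloballyMinimal_e13a13
  have hb := baseChange_mk_int 0 0 0 (-6554469978333963) 206952302283565583167290
  push_cast at hb
  intro q hq; fin_cases hq <;> exact dvd_conductorNorm_of_dvd_Δ _ hb (by norm_num) (by rw [intCurve_Δ]; decide +kernel)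

/-- **Forward edges and anchors from ANY curve `W₁` isogenous to `E` (cell C): a field Heegner for `N_{W₁}` with `d < −4` has `d ≤ −2159`** — `N_{W₁} = N_E` granted modularity
(`ModularForms.conductorNorm_eq_of_isIsogenous_of_modularity`, Atkin–Lehner) and the landed `discr_le_of_heegner_e13a13`. [cite: AtkinLehner1970, Thm. 4] [cite: GrossLMS1991, §1 (p. 235)] -/
theorem discr_le_of_heegner_isogenous_e13a13 (hmod : nonempty_modularParametrizationData) (W₁ : WeierstrassCurve ℚ) [W₁.IsElliptic]
    (hiso : IsIsogenous (⟨0, 0, 0, -6554469978333963, 206952302283565583167290⟩ : WeierstrassCurve ℚ) W₁) (K₀ : Type) [Field K₀] [NumberField K₀] (hK : IsImaginaryQuadratic K₀)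
    (hHN : SatisfiesHeegnerHypothesis (W₁.conductorNorm ℤ) K₀) (hlt : NumberField.discr K₀ < -4) : NumberField.discr K₀ ≤ -2159 := by
  haveI := EisensteinPrimesMazurMCOnCellBKernelCertP13FourthCell.isElliptic_e13a13
  rw [← conductorNorm_eq_of_isIsogenous_of_modularity hmod _ W₁ hiso] at hHN
  exact EisensteinPrimesMazurMCOnCellBKernelCertP13DoorPrice.discr_le_of_heegner_e13a13 K₀ hK hHN hlt

/-- Finite residue check for reverse edges at cell C: no `D ∈ (−1095, −4)` with `D ≡ 1 (8)`, `(D/13) = 1` and `q ∣ D ∨ (D/q) = 1` for `q ∈ [3, 7, 13, 23, 29, 109]`. [folklore] -/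
theorem no_reverse_discr_e13a13 : ∀ D ∈ Finset.Ioo (-1095 : ℤ) (-4), D % 8 = 1 → (D : ZMod 13) ^ 6 = 1 →
    (∀ q ∈ ([3, 7, 13, 23, 29, 109] : List ℕ), (q : ℤ) ∣ D ∨ (D : ZMod q) ^ (q / 2) = 1) → False := by
  decide +kernel

/-- **REVERSE edges into ANY curve `W₁` isogenous to `E` (cell C): every `TwoStepAt 13 U W₁` has second field `K″` with `d_{K″} ≤ −1095` and carries an analytic-rank-ONE
certificate for a curve `Wd` with `W₁ ≅ Wd ⊗ χ_{d_{K″}}`** (granted modularity for `N_{W₁} = N_E`). The first step of every zig-zag of 6⁷'s left door out of the class of `E` is thus an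
`L`-reading: forward `r_an(W₁^{(d)}) = 1`, `|d| ≥ 2159`, or reverse `r_an(Wd) = 1`, `Wd ≅ W₁ ⊗ χ_d`, `|d| ≥ 1095`. [cite: GrossLMS1991, §1 (p. 235)] [cite: AtkinLehner1970, Thm. 4] -/
theorem twoStepAt_into_isogenous_e13a13 (hmod : nonempty_modularParametrizationData) (W₁ : WeierstrassCurve ℚ) [W₁.IsElliptic]
    (hiso : IsIsogenous (⟨0, 0, 0, -6554469978333963, 206952302283565583167290⟩ : WeierstrassCurve ℚ) W₁) (U : WeierstrassCurve ℚ) (h : TwoStepAt 13 U W₁) :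
    ∃ (K : Type) (_ : Field K) (_ : NumberField K), IsImaginaryQuadratic K ∧ NumberField.discr K ≤ -1095 ∧
      ∃ (Wd : WeierstrassCurve ℚ) (_ : Wd.IsElliptic) (_ : Wd.IsGloballyMinimal),
        (∃ C : VariableChange ℚ, C • W₁ = Wd.quadraticTwist (NumberField.discr K : ℚ)) ∧ Wd.analyticRank = 1 := by
  haveI := EisensteinPrimesMazurMCOnCellBKernelCertP13FourthCell.isElliptic_e13a13
  have hN := conductorNorm_eq_of_isIsogenous_of_modularity hmod _ W₁ hiso
  have hb := bad_dvd_conductorNorm_e13a13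
  exact discr_le_of_twoStepAt_into_of_check [3, 7, 13, 23, 29, 109] (hN ▸ hb 2 (by simp)) (by intro q hq; fin_cases hq <;> exact ⟨by norm_num, by decide, hN ▸ hb _ (by simp)⟩)
    (-1095) no_reverse_discr_e13a13 U h

/-! ## Cell D — −46/13 ⊗ χ₋₂₅₃₄ (w6 g20, p757375), `N = 25834519465664`, bad primes `{2} ∪ [7, 13, 23, 29, 181]`: forward/anchor `B = 1095`, reverse `B′ = 1095` -/

/-- The bad primes `{2} ∪ [7, 13, 23, 29, 181]` all divide `N_E` (kernel: `…DoorPrice.dvd_conductorNorm_of_dvd_Δ` from the integer equation). [cite: BombieriGubler2006, 12.5.9(d)] -/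
theorem bad_dvd_conductorNorm_e13a14 : ∀ q ∈ ((2 :: [7, 13, 23, 29, 181]) : List ℕ), q ∣ (⟨0, 0, 0, -8032656845577868, 280771301908554992678640⟩ : WeierstrassCurve ℚ).conductorNorm ℤ := by
  haveI := EisensteinPrimesMazurMCOnCellBKernelCertP13FifthCell.isElliptic_e13a14; haveI := EisensteinPrimesMazurMCOnCellBKernelCertP13FifthCell.isGloballyMinimal_e13a14
  have hb := baseChange_mk_int 0 0 0 (-8032656845577868) 280771301908554992678640
  push_cast at hb
  intro q hq; fin_cases hq <;> exact dvd_conductorNorm_of_dvd_Δ _ hb (by norm_num) (by rw [intCurve_Δ]; decide +kernel)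

/-- **Forward edges and anchors from ANY curve `W₁` isogenous to `E` (cell D): a field Heegner for `N_{W₁}` with `d < −4` has `d ≤ −1095`** — `N_{W₁} = N_E` granted modularity
(`ModularForms.conductorNorm_eq_of_isIsogenous_of_modularity`, Atkin–Lehner) and the landed `discr_le_of_heegner_e13a14`. [cite: AtkinLehner1970, Thm. 4] [cite: GrossLMS1991, §1 (p. 235)] -/
theorem discr_le_of_heegner_isogenous_e13a14 (hmod : nonempty_modularParametrizationData) (W₁ : WeierstrassCurve ℚ) [W₁.IsElliptic]
    (hiso : IsIsogenous (⟨0, 0, 0, -8032656845577868, 280771301908554992678640⟩ : WeierstrassCurve ℚ) W₁) (K₀ : Type) [Field K₀] [NumberField K₀] (hK : IsImaginaryQuadratic K₀)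
    (hHN : SatisfiesHeegnerHypothesis (W₁.conductorNorm ℤ) K₀) (hlt : NumberField.discr K₀ < -4) : NumberField.discr K₀ ≤ -1095 := by
  haveI := EisensteinPrimesMazurMCOnCellBKernelCertP13FifthCell.isElliptic_e13a14
  rw [← conductorNorm_eq_of_isIsogenous_of_modularity hmod _ W₁ hiso] at hHN
  exact EisensteinPrimesMazurMCOnCellBKernelCertP13DoorPrice.discr_le_of_heegner_e13a14 K₀ hK hHN hlt

/-- Finite residue check for reverse edges at cell D: no `D ∈ (−1095, −4)` with `D ≡ 1 (8)`, `(D/13) = 1` and `q ∣ D ∨ (D/q) = 1` for `q ∈ [7, 13, 23, 29, 181]`. [folklore] -/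
theorem no_reverse_discr_e13a14 : ∀ D ∈ Finset.Ioo (-1095 : ℤ) (-4), D % 8 = 1 → (D : ZMod 13) ^ 6 = 1 →
    (∀ q ∈ ([7, 13, 23, 29, 181] : List ℕ), (q : ℤ) ∣ D ∨ (D : ZMod q) ^ (q / 2) = 1) → False := by
  decide +kernel

/-- **REVERSE edges into ANY curve `W₁` isogenous to `E` (cell D): every `TwoStepAt 13 U W₁` has second field `K″` with `d_{K″} ≤ −1095` and carries an analytic-rank-ONE
certificate for a curve `Wd` with `W₁ ≅ Wd ⊗ χ_{d_{K″}}`** (granted modularity for `N_{W₁} = N_E`). The first step of every zig-zag of 6⁷'s left door out of the class of `E` is thus an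
`L`-reading: forward `r_an(W₁^{(d)}) = 1`, `|d| ≥ 1095`, or reverse `r_an(Wd) = 1`, `Wd ≅ W₁ ⊗ χ_d`, `|d| ≥ 1095`. [cite: GrossLMS1991, §1 (p. 235)] [cite: AtkinLehner1970, Thm. 4] -/
theorem twoStepAt_into_isogenous_e13a14 (hmod : nonempty_modularParametrizationData) (W₁ : WeierstrassCurve ℚ) [W₁.IsElliptic]
    (hiso : IsIsogenous (⟨0, 0, 0, -8032656845577868, 280771301908554992678640⟩ : WeierstrassCurve ℚ) W₁) (U : WeierstrassCurve ℚ) (h : TwoStepAt 13 U W₁) :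
    ∃ (K : Type) (_ : Field K) (_ : NumberField K), IsImaginaryQuadratic K ∧ NumberField.discr K ≤ -1095 ∧
      ∃ (Wd : WeierstrassCurve ℚ) (_ : Wd.IsElliptic) (_ : Wd.IsGloballyMinimal),
        (∃ C : VariableChange ℚ, C • W₁ = Wd.quadraticTwist (NumberField.discr K : ℚ)) ∧ Wd.analyticRank = 1 := by
  haveI := EisensteinPrimesMazurMCOnCellBKernelCertP13FifthCell.isElliptic_e13a14
  have hN := conductorNorm_eq_of_isIsogenous_of_modularity hmod _ W₁ hiso
  have hb := bad_dvd_conductorNorm_e13a14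
  exact discr_le_of_twoStepAt_into_of_check [7, 13, 23, 29, 181] (hN ▸ hb 2 (by simp)) (by intro q hq; fin_cases hq <;> exact ⟨by norm_num, by decide, hN ▸ hb _ (by simp)⟩)
    (-1095) no_reverse_discr_e13a14 U h

/-! ## Cell S — −46/13 ⊗ χ₋₁₇₁₁, 13 SPLIT (w6 g20, p757194), `N = 85782220342`, bad primes `{2} ∪ [7, 13, 23, 29, 59]`: forward/anchor `B = 103`, reverse `B′ = 103` -/

/-- The bad primes `{2} ∪ [7, 13, 23, 29, 59]` all divide `N_E` (kernel: `…DoorPrice.dvd_conductorNorm_of_dvd_Δ` from the integer equation). [cite: BombieriGubler2006, 12.5.9(d)] -/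
theorem bad_dvd_conductorNorm_e13a15 : ∀ q ∈ ((2 :: [7, 13, 23, 29, 59]) : List ℕ), q ∣ (⟨1, -1, 1, -228889583912373, 1350526023767167417979⟩ : WeierstrassCurve ℚ).conductorNorm ℤ := by
  haveI := EisensteinPrimesMazurMCOnCellBKernelCertP13SplitA10Cell.isElliptic_e13a15; haveI := EisensteinPrimesMazurMCOnCellBKernelCertP13SplitA10Cell.isGloballyMinimal_e13a15
  have hb := baseChange_mk_int 1 (-1) 1 (-228889583912373) 1350526023767167417979
  push_cast at hb
  intro q hq; fin_cases hq <;> exact dvd_conductorNorm_of_dvd_Δ _ hb (by norm_num) (by rw [intCurve_Δ]; decide +kernel)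

/-- **Forward edges and anchors from ANY curve `W₁` isogenous to `E` (cell S): a field Heegner for `N_{W₁}` with `d < −4` has `d ≤ −103`** — `N_{W₁} = N_E` granted modularity
(`ModularForms.conductorNorm_eq_of_isIsogenous_of_modularity`, Atkin–Lehner) and the landed `discr_le_of_heegner_e13a15`. [cite: AtkinLehner1970, Thm. 4] [cite: GrossLMS1991, §1 (p. 235)] -/
theorem discr_le_of_heegner_isogenous_e13a15 (hmod : nonempty_modularParametrizationData) (W₁ : WeierstrassCurve ℚ) [W₁.IsElliptic]
    (hiso : IsIsogenous (⟨1, -1, 1, -228889583912373, 1350526023767167417979⟩ : WeierstrassCurve ℚ) W₁) (K₀ : Type) [Field K₀] [NumberField K₀] (hK : IsImaginaryQuadratic K₀)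
    (hHN : SatisfiesHeegnerHypothesis (W₁.conductorNorm ℤ) K₀) (hlt : NumberField.discr K₀ < -4) : NumberField.discr K₀ ≤ -103 := by
  haveI := EisensteinPrimesMazurMCOnCellBKernelCertP13SplitA10Cell.isElliptic_e13a15
  rw [← conductorNorm_eq_of_isIsogenous_of_modularity hmod _ W₁ hiso] at hHN
  exact EisensteinPrimesMazurMCOnCellBKernelCertP13DoorPrice.discr_le_of_heegner_e13a15 K₀ hK hHN hlt

/-- Finite residue check for reverse edges at cell S: no `D ∈ (−103, −4)` with `D ≡ 1 (8)`, `(D/13) = 1` and `q ∣ D ∨ (D/q) = 1` for `q ∈ [7, 13, 23, 29, 59]`. [folklore] -/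
theorem no_reverse_discr_e13a15 : ∀ D ∈ Finset.Ioo (-103 : ℤ) (-4), D % 8 = 1 → (D : ZMod 13) ^ 6 = 1 →
    (∀ q ∈ ([7, 13, 23, 29, 59] : List ℕ), (q : ℤ) ∣ D ∨ (D : ZMod q) ^ (q / 2) = 1) → False := by
  decide +kernel

/-- **REVERSE edges into ANY curve `W₁` isogenous to `E` (cell S): every `TwoStepAt 13 U W₁` has second field `K″` with `d_{K″} ≤ −103` and carries an analytic-rank-ONE
certificate for a curve `Wd` with `W₁ ≅ Wd ⊗ χ_{d_{K″}}`** (granted modularity for `N_{W₁} = N_E`). The first step of every zig-zag of 6⁷'s left door out of the class of `E` is thus an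
`L`-reading: forward `r_an(W₁^{(d)}) = 1`, `|d| ≥ 103`, or reverse `r_an(Wd) = 1`, `Wd ≅ W₁ ⊗ χ_d`, `|d| ≥ 103`. [cite: GrossLMS1991, §1 (p. 235)] [cite: AtkinLehner1970, Thm. 4] -/
theorem twoStepAt_into_isogenous_e13a15 (hmod : nonempty_modularParametrizationData) (W₁ : WeierstrassCurve ℚ) [W₁.IsElliptic]
    (hiso : IsIsogenous (⟨1, -1, 1, -228889583912373, 1350526023767167417979⟩ : WeierstrassCurve ℚ) W₁) (U : WeierstrassCurve ℚ) (h : TwoStepAt 13 U W₁) :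
    ∃ (K : Type) (_ : Field K) (_ : NumberField K), IsImaginaryQuadratic K ∧ NumberField.discr K ≤ -103 ∧
      ∃ (Wd : WeierstrassCurve ℚ) (_ : Wd.IsElliptic) (_ : Wd.IsGloballyMinimal),
        (∃ C : VariableChange ℚ, C • W₁ = Wd.quadraticTwist (NumberField.discr K : ℚ)) ∧ Wd.analyticRank = 1 := by
  haveI := EisensteinPrimesMazurMCOnCellBKernelCertP13SplitA10Cell.isElliptic_e13a15
  have hN := conductorNorm_eq_of_isIsogenous_of_modularity hmod _ W₁ hiso
  have hb := bad_dvd_conductorNorm_e13a15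
  exact discr_le_of_twoStepAt_into_of_check [7, 13, 23, 29, 59] (hN ▸ hb 2 (by simp)) (by intro q hq; fin_cases hq <;> exact ⟨by norm_num, by decide, hN ▸ hb _ (by simp)⟩)
    (-103) no_reverse_discr_e13a15 U h

/-! ## Cell I — −32/13 ⊗ χ₋₁₄₇₉ (w6 g20, p759720), `N = 74042484789546`, bad primes `{2} ∪ [3, 7, 13, 17, 29, 163]`: forward/anchor `B = 1223`, reverse `B′ = 399` -/

/-- The bad primes `{2} ∪ [3, 7, 13, 17, 29, 163]` all divide `N_E` (kernel: `…DoorPrice.dvd_conductorNorm_of_dvd_Δ` from the integer equation). [cite: BombieriGubler2006, 12.5.9(d)] -/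
theorem bad_dvd_conductorNorm_e13a16 : ∀ q ∈ ((2 :: [3, 7, 13, 17, 29, 163]) : List ℕ), q ∣ (⟨1, -1, 1, -332636942380889, 3592856931198596701273⟩ : WeierstrassCurve ℚ).conductorNorm ℤ := by
  haveI := EisensteinPrimesMazurMCOnCellBKernelCertP13InertCell.isElliptic_e13a16; haveI := EisensteinPrimesMazurMCOnCellBKernelCertP13InertCell.isGloballyMinimal_e13a16
  have hb := baseChange_mk_int 1 (-1) 1 (-332636942380889) 3592856931198596701273
  push_cast at hb
  intro q hq; fin_cases hq <;> exact dvd_conductorNorm_of_dvd_Δ _ hb (by norm_num) (by rw [intCurve_Δ]; decide +kernel)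

/-- **Forward edges and anchors from ANY curve `W₁` isogenous to `E` (cell I): a field Heegner for `N_{W₁}` with `d < −4` has `d ≤ −1223`** — `N_{W₁} = N_E` granted modularity
(`ModularForms.conductorNorm_eq_of_isIsogenous_of_modularity`, Atkin–Lehner) and the landed `discr_le_of_heegner_e13a16`. [cite: AtkinLehner1970, Thm. 4] [cite: GrossLMS1991, §1 (p. 235)] -/
theorem discr_le_of_heegner_isogenous_e13a16 (hmod : nonempty_modularParametrizationData) (W₁ : WeierstrassCurve ℚ) [W₁.IsElliptic]
    (hiso : IsIsogenous (⟨1, -1, 1, -332636942380889, 3592856931198596701273⟩ : WeierstrassCurve ℚ) W₁) (K₀ : Type) [Field K₀] [NumberField K₀] (hK : IsImaginaryQuadratic K₀)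
    (hHN : SatisfiesHeegnerHypothesis (W₁.conductorNorm ℤ) K₀) (hlt : NumberField.discr K₀ < -4) : NumberField.discr K₀ ≤ -1223 := by
  haveI := EisensteinPrimesMazurMCOnCellBKernelCertP13InertCell.isElliptic_e13a16
  rw [← conductorNorm_eq_of_isIsogenous_of_modularity hmod _ W₁ hiso] at hHN
  exact EisensteinPrimesMazurMCOnCellBKernelCertP13DoorPrice.discr_le_of_heegner_e13a16 K₀ hK hHN hlt

/-- Finite residue check for reverse edges at cell I: no `D ∈ (−399, −4)` with `D ≡ 1 (8)`, `(D/13) = 1` and `q ∣ D ∨ (D/q) = 1` for `q ∈ [3, 7, 13, 17, 29, 163]`. [folklore] -/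
theorem no_reverse_discr_e13a16 : ∀ D ∈ Finset.Ioo (-399 : ℤ) (-4), D % 8 = 1 → (D : ZMod 13) ^ 6 = 1 →
    (∀ q ∈ ([3, 7, 13, 17, 29, 163] : List ℕ), (q : ℤ) ∣ D ∨ (D : ZMod q) ^ (q / 2) = 1) → False := by
  decide +kernel

/-- **REVERSE edges into ANY curve `W₁` isogenous to `E` (cell I): every `TwoStepAt 13 U W₁` has second field `K″` with `d_{K″} ≤ −399` and carries an analytic-rank-ONE
certificate for a curve `Wd` with `W₁ ≅ Wd ⊗ χ_{d_{K″}}`** (granted modularity for `N_{W₁} = N_E`). The first step of every zig-zag of 6⁷'s left door out of the class of `E` is thus an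
`L`-reading: forward `r_an(W₁^{(d)}) = 1`, `|d| ≥ 1223`, or reverse `r_an(Wd) = 1`, `Wd ≅ W₁ ⊗ χ_d`, `|d| ≥ 399`. [cite: GrossLMS1991, §1 (p. 235)] [cite: AtkinLehner1970, Thm. 4] -/
theorem twoStepAt_into_isogenous_e13a16 (hmod : nonempty_modularParametrizationData) (W₁ : WeierstrassCurve ℚ) [W₁.IsElliptic]
    (hiso : IsIsogenous (⟨1, -1, 1, -332636942380889, 3592856931198596701273⟩ : WeierstrassCurve ℚ) W₁) (U : WeierstrassCurve ℚ) (h : TwoStepAt 13 U W₁) :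
    ∃ (K : Type) (_ : Field K) (_ : NumberField K), IsImaginaryQuadratic K ∧ NumberField.discr K ≤ -399 ∧
      ∃ (Wd : WeierstrassCurve ℚ) (_ : Wd.IsElliptic) (_ : Wd.IsGloballyMinimal),
        (∃ C : VariableChange ℚ, C • W₁ = Wd.quadraticTwist (NumberField.discr K : ℚ)) ∧ Wd.analyticRank = 1 := by
  haveI := EisensteinPrimesMazurMCOnCellBKernelCertP13InertCell.isElliptic_e13a16
  have hN := conductorNorm_eq_of_isIsogenous_of_modularity hmod _ W₁ hiso
  have hb := bad_dvd_conductorNorm_e13a16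
  exact discr_le_of_twoStepAt_into_of_check [3, 7, 13, 17, 29, 163] (hN ▸ hb 2 (by simp)) (by intro q hq; fin_cases hq <;> exact ⟨by norm_num, by decide, hN ▸ hb _ (by simp)⟩)
    (-399) no_reverse_discr_e13a16 U h

end Summit.BirchSwinnertonDyer.BirchSwinnertonDyer.Theorems.EisensteinPrimesMazurMCOnCellBKernelCertP13DoorPriceClassI
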